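import Summits.ResolutionOfSingularities.ResolutionOfSingularities.Theorems.PurelyInseparableDim4ResConeLightWeights
import Summits.ResolutionOfSingularities.ResolutionOfSingularities.Theorems.PurelyInseparableDim4IsolatedMultiplicityPairs
import Literature.Barriers.ResolutionOfSingularities.ResidualOrderUnboundedExample2
import HarnessLib
import HarnessLib.Audit.Tags

/-!
# Purely inseparable four-folds — the SHADE-`3` WEIGHT AUTOMATON at `p = 5` WITHOUT a lightness hypothesis:
# light `(1,1,1)` for ever, or eventually the B∞ classes `(2,1)`/`(2,1,1)` for ever with a forced KEEP/LOSE pattern,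
# and the P-VISIT DOCK (cell `res-dim4-pi`, K2(p) lane, slice C at `(p,d) = (5,3)`; holder brick)

[OURS · counted 0 · cell `res-dim4-pi` · K2(p) lane holder res-dim4-p-12 g4 (memo §17 «B∞ kernel route», brick W).]
Nothing here proves K2(5) (`RidgeBudget.NoAboveFloorTrap 5 5`), `NoIsolatedTrap 5 5` or resolution of singularities
in dimension ≥ 4 / characteristic `p` — NOT proved.  AI kernel work, weaker than expert review.

res-dim4-p-9 g3's `…ResConeLightWeights` (K26a, slice B) normalises the boundary weights of a constant-shade-`3`
tail at `p = 5` UNDER the light bound at satellite steps.  Slice C (binary cones, `e_G ≡ 2`) has no such bound; this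
file runs the same `(r, j, b)` numerics with the ISOLATION PAIR BOUND `r_a + r_b ≤ p − 2 = 3`
(`IsolatedBand.apply_add_apply_le_of_isIsolated`) in its place — res-dim4-idea-4's weights-only class automaton
(memo `CONFINE-PROOF.md` §4, `d = 3`) made kernel:
* §1 CORE over `r : ℕ → Fin 4 →₀ ℕ` (law `r_{k+1} = (kept part of r_k).update (j k) (|r_k| − 2)`, floor `|r_k| ≥ 3`,
  pair bound): `no_weight_three` (a weight `≥ 3` is fatal within one step), `degree_le_four` (`|r_k| ≤ 4`, i.e.
  `o_k ∈ {6, 7}`), `apply_le_two`, `heavy_unique` (at most one letter of weight `2`), `heavy_succ` (a weight-`2` letter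
  is passed on for ever: at `|r| = 3` it is KEPT — hitting it breaks the floor —, at `|r| = 4` the newborn letter weighs
  `2`), `light_succ` (all weights `≤ 1` and `|r| = 3` ⇒ all weights `≤ 1` at the child), **`weights_dichotomy`**:
  EITHER `|r_k| = 3` with all weights `≤ 1` for every `k ≥ k₀` (class L = `(1,1,1)`), OR from some `k₁ ≥ k₀` on every
  state carries exactly one letter of weight `2` (classes P = `(2,1)`, Q = `(2,1,1)` — res-dim4-idea-4's B∞);
  and the B∞ step pattern: `keep_heavy_of_degree_three` (a P-step keeps its heavy letter), `hit_heavy_of_degree_four`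
  (a Q-step hits its heavy letter and the newborn one is heavy), `not_isSatellite_of_degree_four_four` (Q → Q steps are free).
* §2 DRESS on witnessed isolated above-floor `Step0 5` chains with `x^{r₀} ∣ F₀` and constant shade `3` from `k₀`
  (no `e_G` hypothesis at all): **`three_weights_dichotomy`**, **`bInf_pattern`**, and the **P-VISIT DOCK
  `no_three_tail_of_degree_three_budget`**: a uniform bound on the number of indices `k ≥ k₁` with `|r_k| = 3` is
  contradictory — the tail would sit in the upper band `o ≡ 7` for ever, excluded by
  `BandLayers.no_isolated_chain_eventually_upper` (res-dim4-p-12 g2).  In the B∞ branch `|r_k| = 3` ⟺ «P-state» ⟺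
  «KEEP step of the critical letter», so this is the socket for the Φ-line's KEEP budget
  (`PhiLine.keepCount_le_betaS`, res-dim4-idea-1 / res-dim4-p-11) at `(5,3)`, FT-free.
What is NOT here: the light branch L at `e_G = 2` (loss-free case = res-dim4-p-5 g3's `no_lossfree_tail` p684130; lossy
light case OPEN), the budget itself, K2(5).

[cite: CossartJannsenSaito2020, Thm. 3.14, Lemma 13.2] [cite: HauserPerlega2019PRIMS, §2 (transform D′ of D)]
bears_on: LADDER-RESOLUTION:D157-DOOR2 (res-dim4-pi · K2(p) · slice C `(5,3)` weights).  Supports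
stmt-ResolutionOfSingularities-16155 (helper).
-/

set_option linter.dupNamespace false -- mandated namespace of this single-conjunct summit

noncomputable section

namespace Summit.ResolutionOfSingularities.ResolutionOfSingularities.Theorems.PIDim4

namespace ResCone

open MvPolynomial Finset
open Literature.AlgebraicGeometry.Resolution
open Literature.AlgebraicGeometry.Resolution.CentreBlowup
open Literature.AlgebraicGeometry.Resolution.Hauser2010
open Literature.AlgebraicGeometry.Resolution.HauserPerlega2019

variable {K : Type} [Field K]

/-! ## 1. Core numerics: the `d = 3`, `p = 5` weight automaton under the pair bound -/

section Core

variable [DecidableEq K]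

/-- Under the pair bound `r_a + r_b ≤ 3`, a letter of weight `≥ 3` carries the whole degree: every other weight is
`0` and `|r| = r_W = 3`. [folklore] -/
theorem eq_three_of_three_le {f : Fin 4 →₀ ℕ} (hpair : ∀ i i', i ≠ i' → f i + f i' ≤ 3) {W : Fin 4}
    (hW : 3 ≤ f W) : f W = 3 ∧ (∀ i, i ≠ W → f i = 0) ∧ f.degree = 3 := by
  have hoth : ∀ i, i ≠ W → f i = 0 := fun i hi => by have := hpair i W hi; omega
  have hW3 : f W = 3 := by
    obtain ⟨i, hi⟩ : ∃ i : Fin 4, i ≠ W := exists_ne W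
    have := hpair W i (Ne.symm hi); have := hoth i hi; omega
  refine ⟨hW3, hoth, ?_⟩
  rw [Literature.Barriers.ResolutionOfSingularities.HauserPerlega.degree_fin4]
  fin_cases W <;> simp_all

/-- **A weight `≥ 3` is fatal**: if `3 ≤ r_k W` at `k ≥ k₀` then the next state breaks the floor or the pair bound —
the newborn letter weighs `1`, and `W` is either hit (then `|r_{k+1}| ≤ 1`) or kept with weight `3` next to it.
[OURS] [folklore] -/
theorem no_weight_three {r : ℕ → Fin 4 →₀ ℕ} {j : ℕ → Fin 4} {b : ℕ → Fin 4 → K} {k₀ : ℕ}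
    (hlaw : ∀ k, k₀ ≤ k → r (k + 1) = ((r k).filter (fun i => b k i = 0)).update (j k) ((r k).degree - 2))
    (hbj : ∀ k, b k (j k) = 0) (hfloor : ∀ k, k₀ ≤ k → 3 ≤ (r k).degree)
    (hpair : ∀ k, k₀ ≤ k → ∀ i i', i ≠ i' → r k i + r k i' ≤ 3) {k : ℕ} (hk : k₀ ≤ k) {W : Fin 4}
    (hW : 3 ≤ r k W) : False := by
  obtain ⟨hW3, -, hdeg⟩ := eq_three_of_three_le (hpair k hk) hW
  by_cases hhit : j k = W ∨ b k W ≠ 0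
  · -- `W` is hit: the floor breaks at `k + 1`
    have h := degree_succ_le_of_hit (hlaw k hk) (hbj k) hhit
    have := hfloor (k + 1) (by omega)
    omega
  · -- `W` is kept next to the newborn letter of weight `1`
    push Not at hhit
    have hkept : r (k + 1) W = 3 := by rw [law_apply_kept (hlaw k hk) hhit.1 hhit.2, hW3]
    have hnew : r (k + 1) (j k) = 1 := by rw [law_apply_self (hlaw k hk), hdeg]
    have := hpair (k + 1) (by omega) (j k) W hhit.1
    omega

/-- **`|r_k| ≤ 4`** (so `o_k ∈ {6, 7}`): otherwise the newborn letter would weigh `≥ 3`. [OURS] [folklore] -/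
theorem degree_le_four {r : ℕ → Fin 4 →₀ ℕ} {j : ℕ → Fin 4} {b : ℕ → Fin 4 → K} {k₀ : ℕ}
    (hlaw : ∀ k, k₀ ≤ k → r (k + 1) = ((r k).filter (fun i => b k i = 0)).update (j k) ((r k).degree - 2))
    (hbj : ∀ k, b k (j k) = 0) (hfloor : ∀ k, k₀ ≤ k → 3 ≤ (r k).degree)
    (hpair : ∀ k, k₀ ≤ k → ∀ i i', i ≠ i' → r k i + r k i' ≤ 3) {k : ℕ} (hk : k₀ ≤ k) :
    (r k).degree ≤ 4 := by
  by_contra h5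
  refine no_weight_three hlaw hbj hfloor hpair (k := k + 1) (by omega) (W := j k) ?_
  rw [law_apply_self (hlaw k hk)]
  omega

/-- **Every weight is `≤ 2`.** [OURS] [folklore] -/
theorem apply_le_two {r : ℕ → Fin 4 →₀ ℕ} {j : ℕ → Fin 4} {b : ℕ → Fin 4 → K} {k₀ : ℕ}
    (hlaw : ∀ k, k₀ ≤ k → r (k + 1) = ((r k).filter (fun i => b k i = 0)).update (j k) ((r k).degree - 2))
    (hbj : ∀ k, b k (j k) = 0) (hfloor : ∀ k, k₀ ≤ k → 3 ≤ (r k).degree)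
    (hpair : ∀ k, k₀ ≤ k → ∀ i i', i ≠ i' → r k i + r k i' ≤ 3) {k : ℕ} (hk : k₀ ≤ k) (i : Fin 4) :
    r k i ≤ 2 := by
  by_contra h
  exact no_weight_three hlaw hbj hfloor hpair hk (W := i) (by omega)

omit [DecidableEq K] in
/-- **At most one heavy letter**: two letters of weight `2` violate the pair bound. [folklore] -/
theorem heavy_unique {f : Fin 4 →₀ ℕ} (hpair : ∀ i i', i ≠ i' → f i + f i' ≤ 3) {W W' : Fin 4}
    (hW : f W = 2) (hW' : f W' = 2) : W = W' := by
  by_contra h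
  have := hpair W W' h
  omega

/-- **A P-step keeps its heavy letter**: at `|r_k| = 3` with `r_k W = 2`, the step neither charts nor translates
`W` (hitting it leaves `|r_{k+1}| ≤ 2`), so `r_{k+1} W = 2` and the newborn letter weighs `1`. [OURS] [folklore] -/
theorem keep_heavy_of_degree_three {r : ℕ → Fin 4 →₀ ℕ} {j : ℕ → Fin 4} {b : ℕ → Fin 4 → K} {k₀ : ℕ}
    (hlaw : ∀ k, k₀ ≤ k → r (k + 1) = ((r k).filter (fun i => b k i = 0)).update (j k) ((r k).degree - 2))
    (hbj : ∀ k, b k (j k) = 0) (hfloor : ∀ k, k₀ ≤ k → 3 ≤ (r k).degree) {k : ℕ} (hk : k₀ ≤ k)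
    (h3 : (r k).degree = 3) {W : Fin 4} (hW : r k W = 2) :
    j k ≠ W ∧ b k W = 0 ∧ r (k + 1) W = 2 ∧ r (k + 1) (j k) = 1 := by
  have hnot : ¬ (j k = W ∨ b k W ≠ 0) := fun hhit => by
    have h := degree_succ_le_of_hit (hlaw k hk) (hbj k) hhit
    have := hfloor (k + 1) (by omega)
    omega
  push Not at hnot
  refine ⟨hnot.1, hnot.2, ?_, ?_⟩
  · rw [law_apply_kept (hlaw k hk) hnot.1 hnot.2, hW]
  · rw [law_apply_self (hlaw k hk), h3]

/-- **A Q-step hits its heavy letter and founds a new one**: at `|r_k| = 4` the newborn letter weighs `2`, so a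
kept old letter of weight `2` would violate the pair bound at `k + 1`: the old heavy letter `W` is charted or
translated. [OURS] [folklore] -/
theorem hit_heavy_of_degree_four {r : ℕ → Fin 4 →₀ ℕ} {j : ℕ → Fin 4} {b : ℕ → Fin 4 → K} {k₀ : ℕ}
    (hlaw : ∀ k, k₀ ≤ k → r (k + 1) = ((r k).filter (fun i => b k i = 0)).update (j k) ((r k).degree - 2))
    (hpair : ∀ k, k₀ ≤ k → ∀ i i', i ≠ i' → r k i + r k i' ≤ 3) {k : ℕ} (hk : k₀ ≤ k)
    (h4 : (r k).degree = 4) {W : Fin 4} (hW : r k W = 2) :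
    (j k = W ∨ b k W ≠ 0) ∧ r (k + 1) (j k) = 2 := by
  have hnew : r (k + 1) (j k) = 2 := by rw [law_apply_self (hlaw k hk), h4]
  refine ⟨?_, hnew⟩
  by_contra h
  push Not at h
  have hkept : r (k + 1) W = 2 := by rw [law_apply_kept (hlaw k hk) h.1 h.2, hW]
  exact h.1 (heavy_unique (hpair (k + 1) (by omega)) hnew hkept)

/-- **Heaviness is hereditary**: a state with a weight-`2` letter is followed by one (kept at `|r| = 3`, newborn at
`|r| = 4`). [OURS] [folklore] -/
theorem heavy_succ {r : ℕ → Fin 4 →₀ ℕ} {j : ℕ → Fin 4} {b : ℕ → Fin 4 → K} {k₀ : ℕ}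
    (hlaw : ∀ k, k₀ ≤ k → r (k + 1) = ((r k).filter (fun i => b k i = 0)).update (j k) ((r k).degree - 2))
    (hbj : ∀ k, b k (j k) = 0) (hfloor : ∀ k, k₀ ≤ k → 3 ≤ (r k).degree)
    (hpair : ∀ k, k₀ ≤ k → ∀ i i', i ≠ i' → r k i + r k i' ≤ 3) {k : ℕ} (hk : k₀ ≤ k)
    (hheavy : ∃ W, r k W = 2) : ∃ W, r (k + 1) W = 2 := by
  obtain ⟨W, hW⟩ := hheavy
  have hle := degree_le_four hlaw hbj hfloor hpair hk
  have hge := hfloor k hk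
  rcases Nat.lt_or_ge (r k).degree 4 with h3 | h4
  · exact ⟨W, (keep_heavy_of_degree_three hlaw hbj hfloor hk (by omega) hW).2.2.1⟩
  · exact ⟨j k, (hit_heavy_of_degree_four hlaw hpair hk (by omega) hW).2⟩

/-- Heaviness for ever from the first heavy state. [OURS] [folklore] -/
theorem heavy_from {r : ℕ → Fin 4 →₀ ℕ} {j : ℕ → Fin 4} {b : ℕ → Fin 4 → K} {k₀ : ℕ}
    (hlaw : ∀ k, k₀ ≤ k → r (k + 1) = ((r k).filter (fun i => b k i = 0)).update (j k) ((r k).degree - 2))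
    (hbj : ∀ k, b k (j k) = 0) (hfloor : ∀ k, k₀ ≤ k → 3 ≤ (r k).degree)
    (hpair : ∀ k, k₀ ≤ k → ∀ i i', i ≠ i' → r k i + r k i' ≤ 3) {k₁ : ℕ} (hk₁ : k₀ ≤ k₁)
    (hheavy : ∃ W, r k₁ W = 2) : ∀ k, k₁ ≤ k → ∃ W, r k W = 2 := by
  intro k hk
  obtain ⟨n, rfl⟩ := Nat.exists_eq_add_of_le hk
  induction n with
  | zero => simpa using hheavy
  | succ n ih =>
    have h := heavy_succ hlaw hbj hfloor hpair (k := k₁ + n) (by omega) (ih (Nat.le_add_right _ _))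
    simpa only [Nat.add_succ] using h

/-- **Light steps stay light or found a heavy letter**: with all weights `≤ 1` and `|r_k| = 3` the newborn letter
weighs `1` and every weight at `k + 1` is `≤ 1`. [folklore] -/
theorem light_succ {r : ℕ → Fin 4 →₀ ℕ} {j : ℕ → Fin 4} {b : ℕ → Fin 4 → K} {k₀ : ℕ}
    (hlaw : ∀ k, k₀ ≤ k → r (k + 1) = ((r k).filter (fun i => b k i = 0)).update (j k) ((r k).degree - 2))
    {k : ℕ} (hk : k₀ ≤ k) (h1 : ∀ i, r k i ≤ 1) (h3 : (r k).degree = 3) (i : Fin 4) : r (k + 1) i ≤ 1 := by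
  rw [law_apply (hlaw k hk)]
  split_ifs
  · omega
  · exact h1 i
  · exact Nat.zero_le _

/-- **THE WEIGHTS DICHOTOMY** (core form): under the law, the floor `|r| ≥ 3` and the pair bound from `k₀` on,
EITHER every state `k ≥ k₀` is LIGHT (`|r_k| = 3`, all weights `≤ 1`: class `(1,1,1)`), OR from some `k₁ ≥ k₀` on
every state carries a (unique) letter of weight `2` (res-dim4-idea-4's B∞ = `{(2,1), (2,1,1)}`). [OURS] [folklore] -/
theorem weights_dichotomy {r : ℕ → Fin 4 →₀ ℕ} {j : ℕ → Fin 4} {b : ℕ → Fin 4 → K} {k₀ : ℕ}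
    (hlaw : ∀ k, k₀ ≤ k → r (k + 1) = ((r k).filter (fun i => b k i = 0)).update (j k) ((r k).degree - 2))
    (hbj : ∀ k, b k (j k) = 0) (hfloor : ∀ k, k₀ ≤ k → 3 ≤ (r k).degree)
    (hpair : ∀ k, k₀ ≤ k → ∀ i i', i ≠ i' → r k i + r k i' ≤ 3) :
    (∀ k, k₀ ≤ k → (∀ i, r k i ≤ 1) ∧ (r k).degree = 3) ∨
    (∃ k₁, k₀ ≤ k₁ ∧ ∀ k, k₁ ≤ k → ∃ W, r k W = 2) := by
  by_cases hall : ∀ k, k₀ ≤ k → (∀ i, r k i ≤ 1) ∧ (r k).degree = 3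
  · exact Or.inl hall
  · right
    push Not at hall
    obtain ⟨k, hk, hbad⟩ := hall
    by_cases hh : ∃ W, r k W = 2
    · exact ⟨k, hk, heavy_from hlaw hbj hfloor hpair hk hh⟩
    · -- all weights `≤ 1` at `k`, hence `|r_k| = 4`: the newborn letter at `k + 1` is heavy
      push Not at hh
      have h1 : ∀ i, r k i ≤ 1 := fun i => by
        have := apply_le_two hlaw hbj hfloor hpair hk i; have := hh i; omega
      have h4 : (r k).degree = 4 := by
        have := degree_le_four hlaw hbj hfloor hpair hk; have := hfloor k hk; have := hbad h1; omega
      refine ⟨k + 1, by omega, heavy_from hlaw hbj hfloor hpair (k₁ := k + 1) (by omega) ⟨j k, ?_⟩⟩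
      rw [law_apply_self (hlaw k hk), h4]

/-- **Q → Q steps are FREE**: if `|r_k| = |r_{k+1}| = 4` then the letter born at step `k` weighs `2` at `k + 1` and
is hit by step `k + 1`, which is therefore not a satellite step. [OURS] [folklore] -/
theorem not_isSatellite_of_degree_four_four {r : ℕ → Fin 4 →₀ ℕ} {j : ℕ → Fin 4} {b : ℕ → Fin 4 → K} {k₀ : ℕ}
    (hlaw : ∀ k, k₀ ≤ k → r (k + 1) = ((r k).filter (fun i => b k i = 0)).update (j k) ((r k).degree - 2))
    (hpair : ∀ k, k₀ ≤ k → ∀ i i', i ≠ i' → r k i + r k i' ≤ 3) {k : ℕ} (hk : k₀ ≤ k)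
    (h4 : (r k).degree = 4) (h4' : (r (k + 1)).degree = 4) : ¬ FreeTail.IsSatellite j b k := by
  intro hsat
  have hnew : r (k + 1) (j k) = 2 := by rw [law_apply_self (hlaw k hk), h4]
  have h := (hit_heavy_of_degree_four hlaw hpair (k := k + 1) (by omega) h4' hnew).1
  rcases h with h | h
  · exact hsat.1 h
  · exact h hsat.2

end Core

/-! ## 2. The dress: witnessed isolated above-floor `Step0 5` chains of constant shade `3` -/

section Chain

variable [DecidableEq K]

/-- The boundary law, floor and pair bound of a witnessed isolated above-floor `Step0 5` chain with `x^{r₀} ∣ F₀`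
and constant shade `3` from `k₀`, in the core's letters (`o_k = |r_k| + 3`). [OURS · bookkeeping] [folklore] -/
theorem three_weights_laws {c : ℕ → State K} {j : ℕ → Fin 4} {b : ℕ → Fin 4 → K}
    (hc : ∀ k, IsIsolated 5 (c k).F ∧ Step0 5 (c k) (c (k + 1))) (hw : FreeTail.IsWitnessedChain 5 c j b)
    (hr0 : ∀ e ∈ (c 0).F.support, (c 0).r ≤ e) (hfloor : ∀ k, ordZero (c k).F ≠ 5) {k₀ : ℕ}
    (hshade : ∀ k, k₀ ≤ k → (c k).shade = ((3 : ℕ) : ℕ∞)) :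
    (∀ k, k₀ ≤ k → ordZero (c k).F = (((c k).r.degree + 3 : ℕ) : ℕ∞)) ∧
    (∀ k, k₀ ≤ k →
      (c (k + 1)).r = ((c k).r.filter (fun i => b k i = 0)).update (j k) ((c k).r.degree - 2)) ∧
    (∀ k, b k (j k) = 0) ∧ (∀ k, k₀ ≤ k → 3 ≤ (c k).r.degree) ∧
    (∀ k, k₀ ≤ k → ∀ i i', i ≠ i' → (c k).r i + (c k).r i' ≤ 3) := by
  haveI : Fact (Nat.Prime 5) := ⟨by norm_num⟩
  have hord : ∀ k, k₀ ≤ k → ordZero (c k).F = (((c k).r.degree + 3 : ℕ) : ℕ∞) := by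
    intro k hk
    obtain ⟨o, ho, hpo, -, hd⟩ := chain_shade_nat 5 hc hfloor hshade hk
    rw [ho]; congr 1; omega
  refine ⟨hord, fun k hk => ?_, fun k => (hw k).2.1, fun k hk => ?_, fun k _ i i' hii' => ?_⟩
  · rw [(hw k).2.2.2.2, step_r_univ' 5 (j k) (b k) (c k) (hord k hk)]
    congr 1
  · obtain ⟨o, ho, hpo, -, hd⟩ := chain_shade_nat 5 hc hfloor hshade hk
    omega
  · have h := IsolatedBand.apply_add_apply_le_of_isIsolated (by norm_num) (hc k).1
      (IsolatedBand.isolated_chain_forall_le hc hr0 k) hii'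
    omega

/-- **THE SHADE-`3` WEIGHTS DICHOTOMY AT `p = 5`** (no `e_G`, no lightness): along a witnessed isolated above-floor
`Step0 5` chain with `x^{r₀} ∣ F₀` and constant shade `3` from `k₀`, EITHER every `k ≥ k₀` is light (`|r_k| = 3`, all
boundary weights `≤ 1`, `o_k = 6`), OR from some `k₁ ≥ k₀` on every state has exactly one boundary letter of weight
`2` (its other weights `≤ 1`, `|r_k| ∈ {3, 4}`): res-dim4-idea-4's B∞. [OURS] [cite: CossartJannsenSaito2020, Thm. 3.14] -/
theorem three_weights_dichotomy {c : ℕ → State K} {j : ℕ → Fin 4} {b : ℕ → Fin 4 → K}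
    (hc : ∀ k, IsIsolated 5 (c k).F ∧ Step0 5 (c k) (c (k + 1))) (hw : FreeTail.IsWitnessedChain 5 c j b)
    (hr0 : ∀ e ∈ (c 0).F.support, (c 0).r ≤ e) (hfloor : ∀ k, ordZero (c k).F ≠ 5) {k₀ : ℕ}
    (hshade : ∀ k, k₀ ≤ k → (c k).shade = ((3 : ℕ) : ℕ∞)) :
    (∀ k, k₀ ≤ k → (∀ i, (c k).r i ≤ 1) ∧ (c k).r.degree = 3) ∨
    (∃ k₁, k₀ ≤ k₁ ∧ ∀ k, k₁ ≤ k → (∃ W, (c k).r W = 2 ∧ ∀ i, i ≠ W → (c k).r i ≤ 1) ∧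
      (3 ≤ (c k).r.degree ∧ (c k).r.degree ≤ 4)) := by
  obtain ⟨-, hlaw, hbj, hfl, hpair⟩ := three_weights_laws hc hw hr0 hfloor hshade
  rcases weights_dichotomy hlaw hbj hfl hpair with h | ⟨k₁, hk₁, h⟩
  · exact Or.inl h
  · refine Or.inr ⟨k₁, hk₁, fun k hk => ?_⟩
    obtain ⟨W, hW⟩ := h k hk
    refine ⟨⟨W, hW, fun i hi => ?_⟩, hfl k (by omega), degree_le_four hlaw hbj hfl hpair (by omega)⟩
    have := hpair k (by omega) i W hi
    omega

/-- **THE B∞ STEP PATTERN**: in the heavy branch, at a state with `|r_k| = 3` (P = `(2,1)`) the step KEEPS the heavy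
letter (neither charts nor translates it; it stays heavy, the newborn letter weighs `1`), and at a state with
`|r_k| = 4` (Q = `(2,1,1)`) the step HITS the heavy letter (charts or translates it) and the newborn letter is the new
heavy one; two consecutive Q-states make a free (non-satellite) step. [OURS] [cite: CossartJannsenSaito2020, Thm. 3.14] -/
theorem bInf_pattern {c : ℕ → State K} {j : ℕ → Fin 4} {b : ℕ → Fin 4 → K}
    (hc : ∀ k, IsIsolated 5 (c k).F ∧ Step0 5 (c k) (c (k + 1))) (hw : FreeTail.IsWitnessedChain 5 c j b)
    (hr0 : ∀ e ∈ (c 0).F.support, (c 0).r ≤ e) (hfloor : ∀ k, ordZero (c k).F ≠ 5) {k₀ : ℕ}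
    (hshade : ∀ k, k₀ ≤ k → (c k).shade = ((3 : ℕ) : ℕ∞)) {k : ℕ} (hk : k₀ ≤ k) {W : Fin 4}
    (hW : (c k).r W = 2) :
    ((c k).r.degree = 3 → j k ≠ W ∧ b k W = 0 ∧ (c (k + 1)).r W = 2 ∧ (c (k + 1)).r (j k) = 1) ∧
    ((c k).r.degree = 4 → (j k = W ∨ b k W ≠ 0) ∧ (c (k + 1)).r (j k) = 2) ∧
    ((c k).r.degree = 4 → (c (k + 1)).r.degree = 4 → ¬ FreeTail.IsSatellite j b k) := by
  obtain ⟨-, hlaw, hbj, hfl, hpair⟩ := three_weights_laws hc hw hr0 hfloor hshade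
  exact ⟨fun h3 => keep_heavy_of_degree_three hlaw hbj hfl hk h3 hW,
    fun h4 => hit_heavy_of_degree_four hlaw hpair hk h4 hW,
    fun h4 h4' => not_isSatellite_of_degree_four_four hlaw hpair hk h4 h4'⟩

/-- **THE P-VISIT DOCK** (FT-free): along a witnessed isolated above-floor `Step0 5` chain with `x^{r₀} ∣ F₀` and
constant shade `3` from `k₀`, the indices `k ≥ k₁` with `|r_k| = 3` (`o_k = 6`; in the B∞ branch: the P-states = the
KEEP steps of the critical letter) cannot be bounded in number: otherwise `o_k = 7` from some index on, an upper-band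
run excluded by `BandLayers.no_isolated_chain_eventually_upper`.  Feed the bound from the Φ-line's
`PhiLine.keepCount_le_betaS`. [OURS] [cite: CossartJannsenSaito2020, Thm. 3.14, Lemma 13.4, Thm. 13.7] -/
theorem no_three_tail_of_degree_three_budget [CharP K 5] {c : ℕ → State K} {j : ℕ → Fin 4} {b : ℕ → Fin 4 → K}
    (hc : ∀ k, IsIsolated 5 (c k).F ∧ Step0 5 (c k) (c (k + 1))) (hw : FreeTail.IsWitnessedChain 5 c j b)
    (hr0 : ∀ e ∈ (c 0).F.support, (c 0).r ≤ e) (hfloor : ∀ k, ordZero (c k).F ≠ 5) {k₀ : ℕ}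
    (hshade : ∀ k, k₀ ≤ k → (c k).shade = ((3 : ℕ) : ℕ∞)) {k₁ : ℕ} (hk₁ : k₀ ≤ k₁) {B : ℕ}
    (hbudget : ∀ n, ((Finset.range n).filter (fun i => (c (k₁ + i)).r.degree = 3)).card ≤ B) : False := by
  haveI : Fact (Nat.Prime 5) := ⟨by norm_num⟩
  classical
  obtain ⟨hord, hlaw, hbj, hfl, hpair⟩ := three_weights_laws hc hw hr0 hfloor hshade
  -- finitely many P-visits: from some `k₂ ≥ k₁` on, `|r_k| ≠ 3`
  have hev : ∃ k₂, k₁ ≤ k₂ ∧ ∀ k, k₂ ≤ k → (c k).r.degree ≠ 3 := by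
    by_contra hno
    push Not at hno
    have hgrow : ∀ m, ∃ n, m ≤ ((Finset.range n).filter (fun i => (c (k₁ + i)).r.degree = 3)).card := by
      intro m
      induction m with
      | zero => exact ⟨0, Nat.zero_le _⟩
      | succ m ih =>
        obtain ⟨n, hn⟩ := ih
        obtain ⟨k, hk, h3⟩ := hno (k₁ + n) (by omega)
        refine ⟨k - k₁ + 1, ?_⟩
        have hsub : (Finset.range n).filter (fun i => (c (k₁ + i)).r.degree = 3) ⊆
            (Finset.range (k - k₁ + 1)).filter (fun i => (c (k₁ + i)).r.degree = 3) := by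
          intro i hi
          simp only [Finset.mem_filter, Finset.mem_range] at hi ⊢
          exact ⟨by omega, hi.2⟩
        have hmem : k - k₁ ∈ (Finset.range (k - k₁ + 1)).filter (fun i => (c (k₁ + i)).r.degree = 3) := by
          simp only [Finset.mem_filter, Finset.mem_range]
          exact ⟨by omega, by rwa [show k₁ + (k - k₁) = k by omega]⟩
        have hnot : k - k₁ ∉ (Finset.range n).filter (fun i => (c (k₁ + i)).r.degree = 3) := by
          simp only [Finset.mem_filter, Finset.mem_range, not_and]
          intro h; omega
        have := Finset.card_lt_card ⟨hsub, fun h => hnot (h hmem)⟩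
        omega
    obtain ⟨n, hn⟩ := hgrow (B + 1)
    have := hbudget n
    omega
  obtain ⟨k₂, hk₂, hne⟩ := hev
  -- hence `|r_k| = 4`, `o_k = 7 ≥ (3·5)/2` for every `k ≥ k₂`
  refine BandLayers.no_isolated_chain_eventually_upper 5 hc (k₀ := k₂) fun k hk => ?_
  have h4 : (c k).r.degree = 4 := by
    have := degree_le_four hlaw hbj hfl hpair (k := k) (by omega)
    have := hfl k (by omega); have := hne k hk; omega
  rw [hord k (by omega), h4]

/-- **THE B∞ HALF OF THE `(5,3)` SOCKET, MODULO THE P-VISIT BUDGET**: along a witnessed isolated above-floor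
`Step0 5` chain with `x^{r₀} ∣ F₀` and constant shade `3` from `k₀`, if the heavy branch of `three_weights_dichotomy`
holds from `k₁` and the number of P-states (`|r_k| = 3`) after `k₁` is uniformly bounded — the KEEP budget the Φ-line
(res-dim4-idea-1 CARD I-1-8, res-dim4-p-11's (K-Φ1)–(K-Φ3)) is to deliver — then `False`; so TAIL-B reduces to the
LIGHT branch `(1,1,1)` plus that budget.  Pure restatement of `no_three_tail_of_degree_three_budget` recording the
intended use; no `e_G` hypothesis is consumed. [OURS] [cite: CossartJannsenSaito2020, Thm. 3.14, Thm. 13.7] -/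
theorem no_bInf_tail_of_pBudget [CharP K 5] {c : ℕ → State K} {j : ℕ → Fin 4} {b : ℕ → Fin 4 → K}
    (hc : ∀ k, IsIsolated 5 (c k).F ∧ Step0 5 (c k) (c (k + 1))) (hw : FreeTail.IsWitnessedChain 5 c j b)
    (hr0 : ∀ e ∈ (c 0).F.support, (c 0).r ≤ e) (hfloor : ∀ k, ordZero (c k).F ≠ 5) {k₀ : ℕ}
    (hshade : ∀ k, k₀ ≤ k → (c k).shade = ((3 : ℕ) : ℕ∞)) {k₁ : ℕ} (hk₁ : k₀ ≤ k₁)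
    (_hheavy : ∀ k, k₁ ≤ k → ∃ W, (c k).r W = 2) {B : ℕ}
    (hbudget : ∀ n, ((Finset.range n).filter (fun i => (c (k₁ + i)).r.degree = 3)).card ≤ B) : False :=
  no_three_tail_of_degree_three_budget hc hw hr0 hfloor hshade hk₁ hbudget

end Chain

end ResCone

end Summit.ResolutionOfSingularities.ResolutionOfSingularities.Theorems.PIDim4

end
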